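import Summits.BirchSwinnertonDyer.Rank1Residual.X1.RankOne
import Literature.NumberTheory.EllipticCurves.LawsonWuthrich2016.ShaIndexBoundReducible
import Literature.NumberTheory.EllipticCurves.Rank1Residual.Typed.KolyvaginCertificate
import Literature.NumberTheory.EllipticCurves.MazurTorsion
import Summits.BirchSwinnertonDyer.Rank1Residual.EisensteinPrimesSupport
import HarnessLib

/-!
# Residual class X1 ∩ {r = 1}: the third per-pair route — the Heegner-index certificate at a
# reducible prime (Lawson–Wuthrich 2016 Thm. 14), on the leaf at `p ∈ {7, 13}`

HONEST FRAMING (cell `b2b-bsdres`, run/shared/lean/b2b/bsd-rank1-residual/, verbatim in every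
file): the goal of the cell is to DELETE the COMBINATION-SHAPED residual classes of the
Birch–Swinnerton-Dyer formula for ALL analytic-rank `≤ 1` elliptic curves over `ℚ` — "full BSD
formula for every rank `≤ 1` curve in class `C`" assembled STRICTLY from published theorems — so
that the rank-`≤ 1` remainder becomes exactly the CONSTRUCTION-SHAPED classes, which are TYPED
(missing-input `Prop`s), NOT attempted. This is not "finishing BSD". CLASS-OWNERS.md (2026-08-20):
row "X1 (r = 1)" — research route; NO CLAIM BEYOND STATED CLASSES; no label change. PER-CURVE
certificate shape, not a class theorem.

Unit `b2b-bsdres-x1a` (X1 prover A, gen 9). Fourth sequel of `X1/RankOne.lean`. The rank-one leaf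
had two per-pair routes in the kernel: (B) Wuthrich Thm. 16 + Perrin-Riou–Schneider + Perrin-Riou 1987
+ `p ∤ #Ш_an` + the SCHNEIDER certificate (`Leaf.mazurMainConjecture_and_bsdp_of_shaAn_unit_of_schneider`),
and on type B Greenberg–Vatsal + the same certificate. The certificate lane of the bsd-percentage
paper closes rank-one pairs at a REDUCIBLE prime by a different published lever, its row `T-LW`
(bsdN/HYPOTHESES.md): Kolyvagin's Heegner-index bound WITHOUT an image hypothesis, as corrected by
Lawson–Wuthrich 2016 Thm. 14 (tree fact `LawsonWuthrich2016.thm14_padicValNat_shaOrder_le`, vendored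
at `p ≥ 7`, `p ≠ 11`, gen 9) — e.g. the five rank-one X1 pairs at `p = 13` with `N < 2·10⁴`
(`7056bm1`, `9408bi1` (type B), `9408cc1`, `11025bb1`, `17787k1`; census `c6census_500k.tsv`: 25
rank-one X1 class-pairs at `13` below `5·10⁵`, 8 of type B) are lane-proved this way. This file keys
that lever to the leaf:

* `Leaf.noPTorsion_of_lawsonWuthrich_of_not_dvd_index`, `Leaf.bsdp_of_lawsonWuthrich_of_not_dvd_index`
  — a leaf pair at `p ≥ 7` (so `p ∈ {7, 13}` on the leaf, `Leaf.seven_or_thirteen`), NO curve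
  `ℚ`-isogenous to `E` with a rational point of order `p`, a Heegner field `K` with `p ∤ d_K`, a
  Heegner point `y_K` of infinite order with `p ∤ [E(K) : ℤ y_K]`, and `p ∤ #Ш_an` ⇒ `Ш(E/ℚ)[p] = 0`
  and `BSD(E,p)` (PUBLISHED: Lawson–Wuthrich `hLW`, GZK `hGZK`); no Schneider certificate, no main
  conjecture, either parity type;
* `Leaf.bsdp_thirteen_of_lawsonWuthrich_of_not_dvd_index` — at `p = 13` the torsion clause is
  Mazur's torsion theorem (`mazur_torsion`, bsd.S05: no rational point of order `13` on any elliptic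
  curve over `ℚ`), so the certificate is just (`K`, `y_K`, `13 ∤ d_K`, `13 ∤ index`, `13 ∤ #Ш_an`).

On the TYPE-B part of the leaf the torsion clause also holds class-wide (a rational `p`-torsion point
anywhere in the class forces type A, `Rank1ResidualX1Defs.not_gvPar_of_isIsogenous_of_torsion`), but
that tree theorem is stated for globally minimal anomalous members, while the fact quantifies over all
isogenous models; the transport is left to a later seat (the hypothesis stays explicit here).

## Status of the input in print (added 2026-08-20, x1a gen 10; decls unchanged) — CONTESTED (reducible case)

Every theorem of this file takes Lawson–Wuthrich 2016 Thm. 14 as a HYPOTHESIS (`hLW :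
thm14_padicValNat_shaOrder_le[_odd]`, a named fact asserting nothing), and on the leaf `E[p]` is always
REDUCIBLE. Matar–Nekovář, J. Théor. Nombres Bordeaux 31 (2019) 455–501, p. 457 §0.10–0.11, write (read
by the cell's referee, referee-2, literature seat and this seat): "the current state of the art requires
an irreducibility assumption for `ρ_{E,p}` (or its restriction to `G_K`) in order to obtain, by
Kolyvagin's method, an upper bound on the size of `Ш(E/K)[p^∞]` without any error terms. As a result,
[GJPST 2009, Thm. 3.7] remains unproved. … the claims made in [LW16, Thm. 14] about the validity of
Theorem 0.3 in situations when (a) holds but `ρ_{E,p}` is reducible are unjustified" (their Correction,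
JTNB 33 (2021), does not touch §0; no reply located, cell FRESHNESS 2026-08-20). Cell rulings R95.2 /
R2-33.2 (2026-08-20): the Literature facts stay with flag `LW16-disputed-MN19` (status note in
`LawsonWuthrich2016/ShaIndexBoundReducible.lean`, p208319), and every closure consuming them at a pair
with `E[p]` reducible — hence EVERY use of this file — is DISPUTED-IN-PRINT: a CONDITIONAL shape, not a
booking route, until the reducible case is settled in print. The kernel theorems below are unaffected as
implications. The LW-free published per-pair routes on the leaf are route B of `X1/RankOne.lean` §3
(`Leaf.mazurMainConjecture_and_bsdp_of_shaAn_unit_of_schneider`: Wuthrich 2014 Thm. 16 — printed for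
`E[p]` reducible —, Perrin-Riou–Schneider, Perrin-Riou 1987, Mazur–Tate sigma, modularity, GZK; certificate
`p ∤ #Ш_an` + `Reg_p ≠ 0`), its modular-symbol form `X1/RankOneCoefficientCertificate.lean`
(`[T¹]L_p ≠ 0`), and on type B `Leaf.bsdp_of_gvPar_of_schneider`; x1a gen 10's census
(`HOME/b2b-bsdres-x1a/gen10/LW-FALLOUT-X1.md`): all 2 404 rank-one X1 class-pairs with `N < 5·10⁵` that
the lane had closed by T-LW carry the route-B certificate values on two engines (nothing booked).

References: [LawsonWuthrich2016] §5 Thm. 14, Thm. 1; [GrigorovJorzaPatrikisSteinTarnita2009] Thm. 3.5;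
[Miller2011LMS] Thms. 4.4, 5.3, Def. 1.1; [Mazur1977] Thm. 8; [Mazur1978] Thm. 1;
[MatarNekovar2019] §0.3, §0.10–0.11 (p. 456–457).
-/

noncomputable section

open scoped Classical

open WeierstrassCurve Literature.NumberTheory.EllipticCurves
  Literature.NumberTheory.EllipticCurves.Rank1Residual
  Literature.NumberTheory.EllipticCurves.Rank1Residual.Typed
  Literature.NumberTheory.EllipticCurves.LawsonWuthrich2016
  Summit.BirchSwinnertonDyer.Rank1Residual

set_option autoImplicit false

namespace Summit.BirchSwinnertonDyer.Rank1Residual.X1.RankOne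

variable {W : WeierstrassCurve ℚ} [W.IsElliptic] [W.IsGloballyMinimal] {p : ℕ} [Fact p.Prime]

/-- On the rank-one leaf, `7 ≤ p` means `p = 7 ∨ p = 13` (granted Mazur 1978 Thm. 1 and the `j`-table
of the positive-genus levels: `EisensteinPrimes.eq_or_of_classX1` gives `p ∈ {3,5,7,13}` for every X1
pair); in particular `p ≠ 11`, the one prime `≥ 7` carrying an exception in Lawson–Wuthrich Thm. 1.
[cite: Mazur1978, Thm. 1 and table p. 129] [cite: CremonaAlgorithms1997, §3.8 p. 82] -/
theorem Leaf.seven_or_thirteen (hMaz : mazur_isogeny_irreducible) (hT : primeDegreeIsogeny_jTable)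
    (h : Leaf W p) (hp7 : 7 ≤ p) : p = 7 ∨ p = 13 := by
  rcases EisensteinPrimes.eq_or_of_classX1 hMaz hT W p h.1 with h3 | h5 | h7 | h13
  · omega
  · omega
  · exact Or.inl h7
  · exact Or.inr h13

/-- **`Ш(E/ℚ)[p] = 0` on the leaf from the Lawson–Wuthrich index certificate** (`p ≥ 7`, `p ≠ 11`):
for a leaf pair, NO `ℚ`-isogenous curve with a rational point of order `p` (`htors`), an imaginary
quadratic `K` with the Heegner hypothesis for the level `N` and `p ∤ d_K`, a Heegner point `P = y_K`
of level `N` of infinite order with `p ∤ [E(K) : ℤ P]` (`hI`): `ord_p #Ш(E/ℚ) = 0` by the PUBLISHED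
named fact `hLW` (Lawson–Wuthrich 2016 Thm. 14; reducible `E[p]` allowed — the point), and `Ш` is
finite by Gross–Zagier–Kolyvagin (`hGZK`), so no nonzero class is killed by `p`.
[cite: LawsonWuthrich2016, §5 Thm. 14 (arXiv:1505.02940 p. 8)] [cite: Miller2011LMS, §4 (y_K, I_K)] -/
theorem Leaf.noPTorsion_of_lawsonWuthrich_of_not_dvd_index (hLW : thm14_padicValNat_shaOrder_le)
    (hGZK : rank_eq_analyticRank_of_analyticRank_le_one) (h : Leaf W p) (hp7 : 7 ≤ p) (hp11 : p ≠ 11)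
    {N : ℕ} [NeZero N] {K : Type} [Field K] [NumberField K] (hK : IsImaginaryQuadratic K)
    (hH : SatisfiesHeegnerHypothesis N K) {P : (W.baseChange K).toAffine.Point}
    (hP : IsHeegnerPoint N W K P) (hnt : ¬ IsOfFinAddOrder P) (hpD : ¬ (p : ℤ) ∣ NumberField.discr K)
    (htors : ∀ (W' : WeierstrassCurve ℚ) [W'.IsElliptic], IsIsogenous W W' →
      ∀ Q : W'.toAffine.Point, p • Q = 0 → Q = 0)
    (hI : ¬ p ∣ (AddSubgroup.zmultiples P).index) : ∀ x : W.sha, (p : ℤ) • x = 0 → x = 0 :=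
  noPTorsion_of_padicValNat_shaOrder_eq_zero W p (hGZK W h.2.le).2
    (LawsonWuthrich2016.padicValNat_shaOrder_eq_zero_of_not_dvd_index hLW W hK hH hP hnt p hp7 hp11
      hpD htors h.2.le hI)

/-- **`BSD(E,p)` on the leaf from the Lawson–Wuthrich index certificate and `p ∤ #Ш_an`** (`p ≥ 7`,
`p ≠ 11`; either parity type; no Schneider certificate, no main conjecture): the third per-pair route
of the rank-one leaf, the one the certificate lane uses at reducible primes (row T-LW). PUBLISHED
inputs: Lawson–Wuthrich Thm. 14 (`hLW`), GZK (`hGZK`); the certificate is (`K`, `y_K`, `p ∤ d_K`,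
`p ∤ [E(K) : ℤ y_K]`, no rational `p`-torsion in the isogeny class, `ord_p #Ш_an = 0`).
[cite: LawsonWuthrich2016, §5 Thm. 14 (arXiv:1505.02940 p. 8)] [cite: Miller2011LMS, Def. 1.1 and §4] -/
theorem Leaf.bsdp_of_lawsonWuthrich_of_not_dvd_index (hLW : thm14_padicValNat_shaOrder_le)
    (hGZK : rank_eq_analyticRank_of_analyticRank_le_one) (h : Leaf W p) (hp7 : 7 ≤ p) (hp11 : p ≠ 11)
    {N : ℕ} [NeZero N] {K : Type} [Field K] [NumberField K] (hK : IsImaginaryQuadratic K)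
    (hH : SatisfiesHeegnerHypothesis N K) {P : (W.baseChange K).toAffine.Point}
    (hP : IsHeegnerPoint N W K P) (hnt : ¬ IsOfFinAddOrder P) (hpD : ¬ (p : ℤ) ∣ NumberField.discr K)
    (htors : ∀ (W' : WeierstrassCurve ℚ) [W'.IsElliptic], IsIsogenous W W' →
      ∀ Q : W'.toAffine.Point, p • Q = 0 → Q = 0)
    (hI : ¬ p ∣ (AddSubgroup.zmultiples P).index)
    {q : ℚ} (hq : shaAn W = (q : ℂ)) (hv : padicValRat p q = 0) : BSDp W p :=
  bsdp_of_shaAn_unit_of_noPTorsion W p hGZK h.2.le hq hv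
    (h.noPTorsion_of_lawsonWuthrich_of_not_dvd_index hLW hGZK hp7 hp11 hK hH hP hnt hpD htors hI)

/-- **No rational point of order `13` on an elliptic curve over `ℚ`** (Mazur 1977 Thm. 8, named fact
`mazur_torsion` for the curve; tree `Mazur1977_addOrderOf_le_of_mazur_torsion`: every torsion point
has order `≤ 10` or `12`). [cite: Mazur1977, Thm. 8] -/
theorem eq_zero_of_thirteen_nsmul_eq_zero (W' : WeierstrassCurve ℚ) [W'.IsElliptic]
    (hMT : mazur_torsion W') (Q : W'.toAffine.Point) (hQ : 13 • Q = 0) : Q = 0 := by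
  by_contra hne
  have hfin : IsOfFinAddOrder Q := isOfFinAddOrder_iff_nsmul_eq_zero.mpr ⟨13, by norm_num, hQ⟩
  have hdvd : addOrderOf Q ∣ 13 := addOrderOf_dvd_of_nsmul_eq_zero hQ
  have h13 : addOrderOf Q = 13 := by
    rcases (Nat.dvd_prime (by norm_num : Nat.Prime 13)).mp hdvd with h1 | h13
    · exact absurd (AddMonoid.addOrderOf_eq_one_iff.mp h1) hne
    · exact h13
  have hle := Mazur1977_addOrderOf_le_of_mazur_torsion W' hMT Q hfin
  omega

/-- **X1 at `p = 13`, rank one: `BSD(E,13)` from the Heegner-index certificate alone.** For a leaf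
pair at `p = 13` (type A or B), the torsion clause of Lawson–Wuthrich Thm. 14 is Mazur's torsion
theorem (`hMT`, bsd.S05, PUBLISHED), so the certificate is: a Heegner field `K` with `13 ∤ d_K`, a
Heegner point of infinite order with `13 ∤ [E(K) : ℤ y_K]`, and `13 ∤ #Ш_an`. This is exactly how the
certificate lane closes the five rank-one X1 pairs at `13` with `N < 2·10⁴` (row T-LW; e.g. `7056bm1`,
`K = ℚ(√-47)`, index odd part `3`). PUBLISHED inputs: `hLW`, `hMT`, `hGZK`. Per pair; not a class
theorem. [cite: LawsonWuthrich2016, §5 Thm. 14] [cite: Mazur1977, Thm. 8] [cite: Miller2011LMS, Def. 1.1] -/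
theorem Leaf.bsdp_thirteen_of_lawsonWuthrich_of_not_dvd_index (hLW : thm14_padicValNat_shaOrder_le)
    (hMT : ∀ (V : WeierstrassCurve ℚ), mazur_torsion V)
    (hGZK : rank_eq_analyticRank_of_analyticRank_le_one) (h : Leaf W p) (hp13 : p = 13)
    {N : ℕ} [NeZero N] {K : Type} [Field K] [NumberField K] (hK : IsImaginaryQuadratic K)
    (hH : SatisfiesHeegnerHypothesis N K) {P : (W.baseChange K).toAffine.Point}
    (hP : IsHeegnerPoint N W K P) (hnt : ¬ IsOfFinAddOrder P) (hpD : ¬ (p : ℤ) ∣ NumberField.discr K)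
    (hI : ¬ p ∣ (AddSubgroup.zmultiples P).index)
    {q : ℚ} (hq : shaAn W = (q : ℂ)) (hv : padicValRat p q = 0) : BSDp W p := by
  subst hp13
  exact h.bsdp_of_lawsonWuthrich_of_not_dvd_index hLW hGZK (by norm_num) (by norm_num) hK hH hP hnt
    hpD (fun W' _ _ Q hQ ↦ eq_zero_of_thirteen_nsmul_eq_zero W' (hMT W') Q hQ) hI hq hv

/-! ### Appended (gen 9): the lever at EVERY leaf prime, Theorem 1's list excluded conservatively -/

/-- On the rank-one leaf `p ≠ 11` (granted Mazur 1978 Thm. 1 and the `j`-table: the leaf primes are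
`3, 5, 7, 13`). [cite: Mazur1978, Thm. 1 and table p. 129] [cite: CremonaAlgorithms1997, §3.8 p. 82] -/
theorem Leaf.ne_eleven (hMaz : mazur_isogeny_irreducible) (hT : primeDegreeIsogeny_jTable)
    (h : Leaf W p) : p ≠ 11 := by
  rcases EisensteinPrimes.eq_or_of_classX1 hMaz hT W p h.1 with h3 | h5 | h7 | h13 <;> omega

/-- **`BSD(E,p)` on the leaf from the Lawson–Wuthrich index certificate — every leaf prime
(`p ∈ {3, 5, 7, 13}`), either parity type, no Schneider certificate, no main conjecture.** Inputs:
the PUBLISHED named facts Lawson–Wuthrich 2016 Thm. 14 in its odd-prime form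
(`hLW : thm14_padicValNat_shaOrder_le_odd`, Theorem 1's list excluded conservatively) and GZK
(`hGZK`); the certificate: an imaginary quadratic `K` with the Heegner hypothesis for the level `N`
and `p ∤ d_K`, a Heegner point `y_K` of infinite order with `p ∤ [E(K) : ℤ y_K]` (`hI`), NO rational
point of order `p` on any `ℚ`-isogenous curve (`htors` — fails on the 1438 type-A census classes
carrying rational `p`-torsion, holds on every type-B class), at `p = 5` no rational `5`-torsion on the
twist by `5` (`htw5`), `p ≠ 11` (`hp11`; automatic on the leaf, `Leaf.ne_eleven`), and
`ord_p #Ш_an = 0` (`hq`, `hv`). This is the certificate lane's row T-LW keyed to the leaf; the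
residual rank-one X1 pairs of RESIDUAL-CASES §a.2 are exactly those the lane could NOT close this way.
[cite: LawsonWuthrich2016, §5 Thm. 14 and Thm. 1 (arXiv:1505.02940 pp. 2, 8)]
[cite: Miller2011LMS, Def. 1.1 and §4] -/
theorem Leaf.bsdp_of_lawsonWuthrich_odd_of_not_dvd_index (hLW : thm14_padicValNat_shaOrder_le_odd)
    (hGZK : rank_eq_analyticRank_of_analyticRank_le_one) (h : Leaf W p) (hp11 : p ≠ 11)
    {N : ℕ} [NeZero N] {K : Type} [Field K] [NumberField K] (hK : IsImaginaryQuadratic K)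
    (hH : SatisfiesHeegnerHypothesis N K) {P : (W.baseChange K).toAffine.Point}
    (hP : IsHeegnerPoint N W K P) (hnt : ¬ IsOfFinAddOrder P) (hpD : ¬ (p : ℤ) ∣ NumberField.discr K)
    (htors : ∀ (W' : WeierstrassCurve ℚ) [W'.IsElliptic], IsIsogenous W W' →
      ∀ Q : W'.toAffine.Point, p • Q = 0 → Q = 0)
    (htw5 : p = 5 → ∀ (W5 : WeierstrassCurve ℚ) [W5.IsElliptic],
      (∃ C : VariableChange ℚ, C • W5 = W.quadraticTwist (5 : ℚ)) →
      ∀ Q : W5.toAffine.Point, 5 • Q = 0 → Q = 0)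
    (hI : ¬ p ∣ (AddSubgroup.zmultiples P).index)
    {q : ℚ} (hq : shaAn W = (q : ℂ)) (hv : padicValRat p q = 0) : BSDp W p :=
  bsdp_of_shaAn_unit_of_noPTorsion W p hGZK h.2.le hq hv
    (noPTorsion_of_padicValNat_shaOrder_eq_zero W p (hGZK W h.2.le).2
      (LawsonWuthrich2016.padicValNat_shaOrder_eq_zero_of_not_dvd_index_odd hLW W hK hH hP hnt p
        h.two_ne hp11 hpD htors htw5 h.2.le hI))

end Summit.BirchSwinnertonDyer.Rank1Residual.X1.RankOne

end
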